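import Mathlib
import HarnessLib
import Literature.Analysis.FluidPDE.VectorCalculus
import Summits.NavierStokesRegularity.NavierStokesRegularity.Theorems.UnthreadedDoorNetFluxOneSidedLawPointwise

/-!
# Route `UnthreadedDoor` / `ThreadingFlux`, crux `PoloidalLiouville` (stmt-NavierStokesRegularity-1222), antidynamo v2 skeleton
# (sha16 `4ebf5683127b`), WALL `stub_scalarLiouville`: the potential law in TANGENTIAL-DRIFT FORM (the equation an «engine» must start from)

Support file (seat leafhand-ns-unthreadeddoor-2 g5, cell decomp-ns), `--supports stmt-NavierStokesRegularity-1222 --as helper`; theorems only.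

THE POINT.  Hypothesis (E1) of `StubScalarLiouville` (`∇(𝓛T) × y = ∇m × ∇T`, `y = x − x₀`, `m = ⟪v, y⟫`, `𝓛T = ∂ₜT + ⟪v, ∇T⟫ − ΔT`) has the
conservative form `(𝓛T)·y = m ∇T − ∇P` with the head `P` (tree `CapSym.headPotentialExists`, slice by slice `NetFlux.exists_headPotential`).  Its
RADIAL component is `𝓛T = (m ∂_y T − ∂_y P)/‖y‖²`, and since `m ∂_yT/‖y‖² = ⟪(⟪v,y⟫/‖y‖²) y, ∇T⟫` is exactly the radial part of the advection, the
RADIAL ADVECTION CANCELS: the toroidal potential is advected ONLY by the tangential velocity,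

  `∂ₜT + ⟪v − (⟪v,y⟫/‖y‖²) y, ∇T⟫ − ΔT = −⟪y, ∇P⟫/‖y‖²`      (`y = x − x₀ ≠ 0`).

This is the precise scalar law a KNSS-type ENGINE for the wall has to place in the solution class of Lemma 2.1 (tree `KNSS2009_lemma21_halfball`;
the OBSTRUCTION half is `ShellMean.not_halfballs_rayGauge`, `…WallShellMeanBall`): drift `v_tan = v − (⟪v,y⟩/‖y‖²) y` (bounded by `‖v‖`,
tangent to the spheres), forcing `−∂ᵣP/r`.

* `law_of_head` — pointwise algebra: `L·y = m ∇T − ∇P`, `y ≠ 0` ⇒ `L = (m ⟪y, ∇T⟫ − ⟪y, ∇P⟫)/‖y‖²`;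
* `tangentialLaw_of_head` — with `L = ∂ₜT + ⟪v,∇T⟫ − ΔT`, `m = ⟪v, y⟫`: the displayed law;
* `inner_tangentialDrift_eq_zero`, `norm_tangentialDrift_le` — the drift is tangent to the spheres and bounded by `‖v‖`;
* ★ `exists_head_tangentialLaw` — on a backward window `(t₀, 0)`, for `v` smooth, `T` smooth off `x₀` and (E1) (`NetFlux.CurledLaw`), there is a
  head `P(t,·) ∈ C¹(ℝ³ ∖ {x₀})` with the displayed law at every `t ∈ (t₀,0)`, `x ≠ x₀`.

HONEST LABEL: one line of algebra on top of the tree's head potential; nothing here proves `stub_scalarLiouville`, `PoloidalLiouville` (1222) or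
bears on Navier–Stokes regularity; no summit statement is proved. [folklore]
-/

noncomputable section

-- the summit and its single sub-problem share the name (CONVENTIONS §1)
set_option linter.dupNamespace false

open scoped Topology InnerProductSpace RealInnerProductSpace ContDiff
open Filter Set Function Metric
open Literature.Analysis.FluidPDE

namespace Summit.NavierStokesRegularity.NavierStokesRegularity.Theorems.PoloidalLiouville.Antidynamo

namespace PotentialLaw

open Summit.NavierStokesRegularity.NavierStokesRegularity.Theorems.PoloidalLiouville.NetFlux (E3 CurledLaw exists_headPotential)

/-- **Radial component of the head equation**: `L·y = m ∇T − ∇P` with `y ≠ 0` gives `L = (m ⟪y, ∇T⟫ − ⟪y, ∇P⟫)/‖y‖²`. [folklore] -/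
theorem law_of_head {L m : ℝ} {y gT gP : EuclideanSpace ℝ (Fin 3)} (hy : y ≠ 0)
    (hhead : L • y = m • gT - gP) :
    L = (m * ⟪y, gT⟫ - ⟪y, gP⟫) / ‖y‖ ^ 2 := by
  have hy2 : ‖y‖ ^ 2 ≠ 0 := pow_ne_zero _ (norm_ne_zero_iff.mpr hy)
  have h := congrArg (fun z => ⟪y, z⟫) hhead
  simp only [inner_smul_right, inner_sub_right, real_inner_self_eq_norm_sq] at h
  rw [eq_div_iff hy2]
  linarith

/-- **The tangential-drift form of the potential law** (pointwise algebra): if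
`(Tₜ + ⟪v, ∇T⟫ − ΔT)·y = ⟪v, y⟫ ∇T − ∇P` at a point with `y ≠ 0`, then
`Tₜ + ⟪v − (⟪v,y⟫/‖y‖²) y, ∇T⟫ − ΔT = −⟪y, ∇P⟫/‖y‖²` — the radial advection cancels. [folklore] -/
theorem tangentialLaw_of_head {Tt ΔT : ℝ} {v y gT gP : EuclideanSpace ℝ (Fin 3)} (hy : y ≠ 0)
    (hhead : (Tt + ⟪v, gT⟫ - ΔT) • y = ⟪v, y⟫ • gT - gP) :
    Tt + ⟪v - (⟪v, y⟫ / ‖y‖ ^ 2) • y, gT⟫ - ΔT = -⟪y, gP⟫ / ‖y‖ ^ 2 := by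
  have hy2 : ‖y‖ ^ 2 ≠ 0 := pow_ne_zero _ (norm_ne_zero_iff.mpr hy)
  have h := law_of_head hy hhead
  have hTt : Tt = (⟪v, y⟫ * ⟪y, gT⟫ - ⟪y, gP⟫) / ‖y‖ ^ 2 - ⟪v, gT⟫ + ΔT := by linarith
  rw [inner_sub_left, inner_smul_left, hTt]
  simp only [conj_trivial]
  field_simp
  ring

/-- The tangential drift `v − (⟪v,y⟫/‖y‖²) y` is tangent to the sphere through `y`. [folklore] -/
theorem inner_tangentialDrift_eq_zero (v y : EuclideanSpace ℝ (Fin 3)) (hy : y ≠ 0) :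
    ⟪v - (⟪v, y⟫ / ‖y‖ ^ 2) • y, y⟫ = 0 := by
  have hy2 : ‖y‖ ^ 2 ≠ 0 := pow_ne_zero _ (norm_ne_zero_iff.mpr hy)
  rw [inner_sub_left, inner_smul_left, real_inner_self_eq_norm_sq]
  simp only [conj_trivial]
  field_simp
  ring

/-- The tangential drift is bounded by the velocity: `‖v − (⟪v,y⟫/‖y‖²) y‖ ≤ ‖v‖` (it is an orthogonal projection). [folklore] -/
theorem norm_tangentialDrift_le (v y : EuclideanSpace ℝ (Fin 3)) (hy : y ≠ 0) :
    ‖v - (⟪v, y⟫ / ‖y‖ ^ 2) • y‖ ≤ ‖v‖ := by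
  have hy2 : ‖y‖ ^ 2 ≠ 0 := pow_ne_zero _ (norm_ne_zero_iff.mpr hy)
  have hypos : 0 < ‖y‖ ^ 2 := by positivity
  -- Pythagoras: `‖v‖² = ‖v_tan‖² + ⟪v,y⟫²/‖y‖²`
  have hsq : ‖v - (⟪v, y⟫ / ‖y‖ ^ 2) • y‖ ^ 2 = ‖v‖ ^ 2 - ⟪v, y⟫ ^ 2 / ‖y‖ ^ 2 := by
    rw [norm_sub_sq_real, norm_smul, inner_smul_right, Real.norm_eq_abs, mul_pow, sq_abs]
    field_simp
    ring
  have hle : ‖v - (⟪v, y⟫ / ‖y‖ ^ 2) • y‖ ^ 2 ≤ ‖v‖ ^ 2 := by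
    rw [hsq]
    have : 0 ≤ ⟪v, y⟫ ^ 2 / ‖y‖ ^ 2 := by positivity
    linarith
  exact (pow_le_pow_iff_left₀ (norm_nonneg _) (norm_nonneg _) two_ne_zero).mp hle

/-- ★ **The head and the tangential law on a backward window.**  For `v` smooth on `(t₀,0) × ℝ³`, `T` smooth on `(t₀,0) × (ℝ³ ∖ {x₀})` and
(E1) in curl form (`NetFlux.CurledLaw`), there is a head `P(t,·) ∈ C¹(ℝ³ ∖ {x₀})` with
`∂ₜT + ⟪v − (⟪v,y⟫/‖y‖²) y, ∇T⟫ − ΔT = −⟪y, ∇P⟫/‖y‖²` at every `t ∈ (t₀,0)`, `x ≠ x₀` (`y = x − x₀`). [folklore] -/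
theorem exists_head_tangentialLaw {v : ℝ → E3 → E3} {T : ℝ → E3 → ℝ} {x₀ : E3} {t₀ : ℝ}
    (hv : ContDiffOn ℝ (⊤ : ℕ∞) (uncurry v) (Ioo t₀ 0 ×ˢ (univ : Set E3)))
    (hT : ContDiffOn ℝ (⊤ : ℕ∞) (uncurry T) (Ioo t₀ 0 ×ˢ ({x₀}ᶜ : Set E3))) (hE1 : CurledLaw v x₀ T (Ioo t₀ 0)) :
    ∃ P : ℝ → E3 → ℝ, (∀ t ∈ Ioo t₀ 0, ContDiffOn ℝ 1 (P t) ({x₀}ᶜ : Set E3)) ∧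
      ∀ t ∈ Ioo t₀ 0, ∀ x, x ≠ x₀ →
        deriv (fun s => T s x) t
            + ⟪v t x - (⟪v t x, x - x₀⟫ / ‖x - x₀‖ ^ 2) • (x - x₀), gradient (T t) x⟫
            - Laplacian.laplacian (T t) x
          = -⟪x - x₀, gradient (P t) x⟫ / ‖x - x₀‖ ^ 2 := by
  obtain ⟨P, hP1, hhead⟩ := exists_headPotential hv hT hE1
  refine ⟨P, hP1, fun t ht x hx => ?_⟩
  exact tangentialLaw_of_head (sub_ne_zero.mpr hx) (hhead t ht x hx)

/-- ★ **The same law from the binders of the wall** (`StubScalarLiouville` quantifies (E1) over all `t < 0`; a backward window `(t₀, 0)` with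
any `t₀ < 0` is served by restriction). [folklore] -/
theorem exists_head_tangentialLaw_of_wall {v : ℝ → E3 → E3} {T : ℝ → E3 → ℝ} {x₀ : E3}
    (hsm : ContDiffOn ℝ (⊤ : ℕ∞) (uncurry v) (Iio 0 ×ˢ (univ : Set E3)))
    (hsT : ContDiffOn ℝ (⊤ : ℕ∞) (uncurry T) (Iio 0 ×ˢ ({x₀}ᶜ : Set E3)))
    (hE : ∀ t < 0, ∀ x, x ≠ x₀ →
      cross (gradient (fun z => deriv (fun s => T s z) t + inner ℝ (v t z) (gradient (T t) z)
            - Laplacian.laplacian (T t) z) x) (x - x₀) =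
        cross (gradient (fun z => inner ℝ (v t z) (z - x₀)) x) (gradient (T t) x))
    (t₀ : ℝ) :
    ∃ P : ℝ → E3 → ℝ, (∀ t ∈ Ioo t₀ 0, ContDiffOn ℝ 1 (P t) ({x₀}ᶜ : Set E3)) ∧
      ∀ t ∈ Ioo t₀ 0, ∀ x, x ≠ x₀ →
        deriv (fun s => T s x) t
            + ⟪v t x - (⟪v t x, x - x₀⟫ / ‖x - x₀‖ ^ 2) • (x - x₀), gradient (T t) x⟫
            - Laplacian.laplacian (T t) x
          = -⟪x - x₀, gradient (P t) x⟫ / ‖x - x₀‖ ^ 2 := by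
  have hsub : Ioo t₀ 0 ×ˢ (univ : Set E3) ⊆ Iio 0 ×ˢ (univ : Set E3) :=
    prod_mono (fun t ht => ht.2) le_rfl
  have hsub' : Ioo t₀ 0 ×ˢ ({x₀}ᶜ : Set E3) ⊆ Iio 0 ×ˢ ({x₀}ᶜ : Set E3) :=
    prod_mono (fun t ht => ht.2) le_rfl
  exact exists_head_tangentialLaw (hsm.mono hsub) (hsT.mono hsub') fun t ht x hx => hE t ht.2 x hx

end PotentialLaw

end Summit.NavierStokesRegularity.NavierStokesRegularity.Theorems.PoloidalLiouville.Antidynamo
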